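import Mathlib.Tactic
import HarnessLib
import Summits.CriticalPhenomena.PercolationContinuityZ3.Theorems.PercNearOneGluingNoHeavyLowerTailCubicThreePointBernsteinStep

/-!
# Kozma–Nitzan's Question 8 at three relays — PEELING A LEAF of the marker's star: the cubic pencil of the local
# centring functional along an inner edge at `v`, and the majorisation lemmas behind `D ≥ 0`

Support file (`--supports stmt-CriticalPhenomena-4575`, closed crux; independent mathematics on Kozma–Nitzan's Question 8,
arXiv:2401.12397 §5.5 p. 36), prover `prim-ineq-gen-6` (gen 17).  No definitions, no named facts, no sorries; standard axioms.
Memos `run/shared/lean/prim/prim-ineq-gen-6/PROOF-STAR-G17.md` §2, §6 and `FINDING-G17.md`; companion of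
`…KnQuestion8IslandSlice.lean` (gen 16: the v-island slice identity).

Setting (memo §0–§2).  After the v-island reduction the centring functional of the cell is
`(★★) = Ψ(Λ) := E⁰ − A_E − A_P/π̄ + ē·A_PM/π̄_M` in the 7-vector `Λ = (E⁰, A_E, A_P, A_PM, π̄, ē, π̄_M)`, and along an inner edge
`e = vw` AT the marker (open with probability `q`) the vector is LINEAR: `Λ(q) = (1−q)·Λ_del + q·Λ_J` (deleted / contracted minor).
Writing `F_X(s,t) := C_X − s·S_X + t·T_X` (`C_X = E⁰_X − A_{E,X}`, `S_X = A_{P,X}`, `T_X = A_{PM,X}`, `X ∈ {J, del}`) and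
`(a_i, b_i, c_i) = (π̄, π̄_M, ē)` of the two minors, the cleared functional `N(q) := π̄(q)·π̄_M(q)·(★★)(q)` is the cubic
  `N(q) = q·(a b C_J − b S_J + a c T_J) + (1−q)·(a b C_del − b S_del + a c T_del)`,  `a = q a₁ + (1−q) a₀` etc.
* `PocketCert.peel_cubic_eq` — its Bernstein form: `N = B₀(1−q)³ + B₁ q(1−q)² + B₂ q²(1−q) + B₃ q³` with
  `B₀ = a₀b₀F_del(P₀₀)`, `B₃ = a₁b₁F_J(P₁₁)`, `B₁ = a₀b₀F_J(P₀₀) + a₁b₀F_del(P₁₀) + a₀b₁F_del(P₀₁)`,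
  `B₂ = a₁b₀F_J(P₁₀) + a₀b₁F_J(P₀₁) + a₁b₁F_del(P₁₁)`, `a_ib_j·F_X(P_{ij}) = a_ib_jC_X − b_jS_X + a_ic_jT_X` (the four 'cross odds'
  `P_{ij} = (1/a_i, c_j/b_j)`).  `B₀, B₃ ≥ 0` are the functional of the two smaller types; the memo's census shows `B₁, B₂ ≥ 0`.
* `PocketCert.peel_nonneg_of_bernstein` — hence `N(q) ≥ 0` on `[0,1]` once the four coefficients are nonnegative (the induction step
  on the number of inner edges at `v`, via `CubicThreePointStep.bernstein_cubic_nonneg`).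
* `PocketCert.majorisation_two` — LEMMA M of the memo (§6(b)): `x ≥ max(u,v)`, `y ≤ min(u,v)`, `x+y ≥ u+v` and the same for
  `(X,Y,U,V)`, all nonnegative ⟹ `xX + yY ≥ uU + vV`.
* `PocketCert.majorisation_step_defect` — the `κ = 2` step of THEOREM D (§6(c)): the out-values of the peeled leaf have a defect
  (`x_o = v_o`, `x_o ≥ u_o ≥ y_o`), the in-values have `y_i = u_i`, `x_i ≥ u_i`, and the defect is paid by `x_i − v_i ≥ u_o − y_o` through the
  nesting `V₁ ≥ Y₀` of the two fibre up-sets.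
These are the kernel-checkable skeleton of THEOREM D (memo §6: the `ΔG`-part `D` of every q-Bernstein coefficient of the star functional is
nonnegative); the percolation dictionary (which masses are `x,y,u,v`) is in the memo.
[cite: KozmaNitzan2024, Question 8 (§5.5 p. 36)]
-/

namespace Summit.CriticalPhenomena.PercolationContinuityZ3.Theorems

namespace PocketCert

/-- **Peeling a leaf: Bernstein form of the cubic pencil.**  Pure ring identity (dictionary in the module docstring).
[cite: KozmaNitzan2024, Question 8 (§5.5 p. 36)] -/
theorem peel_cubic_eq (q a₀ a₁ b₀ b₁ c₀ c₁ CJ SJ TJ Cd Sd Td : ℝ) :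
    let a := q * a₁ + (1 - q) * a₀
    let b := q * b₁ + (1 - q) * b₀
    let c := q * c₁ + (1 - q) * c₀
    let B₀ := a₀ * b₀ * Cd - b₀ * Sd + a₀ * c₀ * Td
    let B₃ := a₁ * b₁ * CJ - b₁ * SJ + a₁ * c₁ * TJ
    let B₁ := (a₀ * b₀ * CJ - b₀ * SJ + a₀ * c₀ * TJ) + (a₁ * b₀ * Cd - b₀ * Sd + a₁ * c₀ * Td) +
      (a₀ * b₁ * Cd - b₁ * Sd + a₀ * c₁ * Td)
    let B₂ := (a₁ * b₀ * CJ - b₀ * SJ + a₁ * c₀ * TJ) + (a₀ * b₁ * CJ - b₁ * SJ + a₀ * c₁ * TJ) +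
      (a₁ * b₁ * Cd - b₁ * Sd + a₁ * c₁ * Td)
    q * (a * b * CJ - b * SJ + a * c * TJ) + (1 - q) * (a * b * Cd - b * Sd + a * c * Td) =
      B₀ * (1 - q) ^ 3 + B₁ * ((1 - q) ^ 2 * q) + B₂ * ((1 - q) * q ^ 2) + B₃ * q ^ 3 := by
  intro a b c B₀ B₃ B₁ B₂
  simp only [a, b, c, B₀, B₃, B₁, B₂]
  ring

/-- **The induction step along an edge at the marker**: if the two end functionals (`B₀`, `B₃`: the deleted and the contracted
type) and the two cross coefficients `B₁, B₂` are nonnegative, the cleared functional is nonnegative for every edge weight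
`q ∈ [0,1]`. [cite: KozmaNitzan2024, Question 8 (§5.5 p. 36)] -/
theorem peel_nonneg_of_bernstein (q a₀ a₁ b₀ b₁ c₀ c₁ CJ SJ TJ Cd Sd Td : ℝ) (hq0 : 0 ≤ q) (hq1 : q ≤ 1)
    (h₀ : 0 ≤ a₀ * b₀ * Cd - b₀ * Sd + a₀ * c₀ * Td)
    (h₃ : 0 ≤ a₁ * b₁ * CJ - b₁ * SJ + a₁ * c₁ * TJ)
    (h₁ : 0 ≤ (a₀ * b₀ * CJ - b₀ * SJ + a₀ * c₀ * TJ) + (a₁ * b₀ * Cd - b₀ * Sd + a₁ * c₀ * Td) +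
      (a₀ * b₁ * Cd - b₁ * Sd + a₀ * c₁ * Td))
    (h₂ : 0 ≤ (a₁ * b₀ * CJ - b₀ * SJ + a₁ * c₀ * TJ) + (a₀ * b₁ * CJ - b₁ * SJ + a₀ * c₁ * TJ) +
      (a₁ * b₁ * Cd - b₁ * Sd + a₁ * c₁ * Td)) :
    let a := q * a₁ + (1 - q) * a₀
    let b := q * b₁ + (1 - q) * b₀
    let c := q * c₁ + (1 - q) * c₀
    0 ≤ q * (a * b * CJ - b * SJ + a * c * TJ) + (1 - q) * (a * b * Cd - b * Sd + a * c * Td) := by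
  have key := peel_cubic_eq q a₀ a₁ b₀ b₁ c₀ c₁ CJ SJ TJ Cd Sd Td
  simp only at key ⊢
  rw [key]
  exact CubicThreePointStep.bernstein_cubic_nonneg h₀ h₁ h₂ h₃ hq0 hq1

/-- **LEMMA M (two-factor majorisation).**  If `x ≥ u`, `y ≤ min(u,v)`, `x + y ≥ u + v` (so also `x ≥ v`) and likewise
`X ≥ max(U,V)`, `Y ≤ min(U,V)`, `X + Y ≥ U + V`, all eight numbers nonnegative, then `xX + yY ≥ uU + vV`.
(Proof in the memo: for `U ≥ V`, `xX+yY−uU−vV ≥ (x−y)(V−Y) + (v−y)(U−V)`.) [folklore] -/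
theorem majorisation_two {x y u v X Y U V : ℝ}
    (hy : 0 ≤ y) (hY : 0 ≤ Y)
    (hxu : u ≤ x) (hyu : y ≤ u) (hyv : y ≤ v) (hs : u + v ≤ x + y)
    (hXU : U ≤ X) (hXV : V ≤ X) (hYU : Y ≤ U) (hYV : Y ≤ V) (hS : U + V ≤ X + Y) :
    u * U + v * V ≤ x * X + y * Y := by
  have hxv : v ≤ x := by linarith
  rcases le_total V U with hVU | hUV
  · nlinarith [mul_nonneg (sub_nonneg.2 hxu) (sub_nonneg.2 hXU), mul_nonneg (sub_nonneg.2 hyv) (sub_nonneg.2 hYV),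
      mul_nonneg (sub_nonneg.2 hyv) (sub_nonneg.2 hVU), mul_nonneg (sub_nonneg.2 (le_trans hyu hxu)) (sub_nonneg.2 hYV),
      mul_nonneg (le_trans hy hyv) (sub_nonneg.2 hVU), mul_nonneg (le_trans hy (le_trans hyu hxu)) (sub_nonneg.2 hXU),
      mul_nonneg (le_trans hy (le_trans hyu hxu)) hY, mul_nonneg (sub_nonneg.2 hs) (le_trans hY hYU)]
  · nlinarith [mul_nonneg (sub_nonneg.2 hxv) (sub_nonneg.2 hXV), mul_nonneg (sub_nonneg.2 hyu) (sub_nonneg.2 hYU),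
      mul_nonneg (sub_nonneg.2 hyu) (sub_nonneg.2 hUV), mul_nonneg (sub_nonneg.2 (le_trans hyv hxv)) (sub_nonneg.2 hYU),
      mul_nonneg (le_trans hy hyu) (sub_nonneg.2 hUV), mul_nonneg (le_trans hy (le_trans hyv hxv)) (sub_nonneg.2 hXV),
      mul_nonneg (le_trans hy (le_trans hyv hxv)) hY, mul_nonneg (sub_nonneg.2 hs) (le_trans hY hYV)]

/-- **The defect step of THEOREM D** (memo §6(c), `κ = 2`): with out-values `(x_o, y_o, u_o, v_o = x_o)`, in-values
`(x_i, y_i = u_i, v_i)` of the peeled leaf and fibre sums `(X₀,Y₀,U₀,V₀)`, `(X₁,Y₁,U₁,V₁)` of the two nested up-sets,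
the two-bracket sum is nonnegative although `x_o + y_o < u_o + v_o` may hold: the defect `u_o − y_o` is paid by `x_i − v_i`
through `V₁ ≥ Y₀` (only the hypotheses actually needed are kept). [cite: KozmaNitzan2024, Question 8 (§5.5 p. 36)] -/
theorem majorisation_step_defect {xo yo uo xi yi vi X₀ Y₀ U₀ V₀ X₁ Y₁ U₁ V₁ : ℝ}
    (hxo : 0 ≤ xo) (hxi : 0 ≤ xi) (hY₀ : 0 ≤ Y₀)
    (h1 : uo ≤ xo) (h3 : yi ≤ xi) (h4 : vi ≤ xi) (h5 : uo - yo ≤ xi - vi)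
    (hA : U₀ + V₀ ≤ X₀ + Y₀) (hB : Y₀ ≤ U₀) (hC : U₁ + V₁ ≤ X₁ + Y₁) (hD : Y₁ ≤ U₁) (hE : Y₀ ≤ V₁) :
    0 ≤ (xo * X₀ + yo * Y₀ - uo * U₀ - xo * V₀) + (xi * X₁ + yi * Y₁ - yi * U₁ - vi * V₁) := by
  -- first bracket ≥ (xo−uo)(U₀−Y₀) − (uo−yo)Y₀ ; second bracket ≥ (xi−yi)(U₁−Y₁) + (xi−vi)V₁
  nlinarith [mul_le_mul_of_nonneg_left (show U₀ - Y₀ ≤ X₀ - V₀ by linarith) hxo,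
    mul_le_mul_of_nonneg_left (show U₁ - Y₁ ≤ X₁ - V₁ by linarith) hxi,
    mul_nonneg (sub_nonneg.2 h1) (sub_nonneg.2 hB), mul_nonneg (sub_nonneg.2 h3) (sub_nonneg.2 hD),
    mul_le_mul_of_nonneg_left hE (show 0 ≤ xi - vi by linarith),
    mul_le_mul_of_nonneg_right h5 hY₀]

end PocketCert

end Summit.CriticalPhenomena.PercolationContinuityZ3.Theorems
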